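import Summits.ValiantsHypothesis.ValiantsHypothesis.Theses.DivisionGap
import Summits.ValiantsHypothesis.ValiantsHypothesis.Theorems.TriangularDimersDivisionEasy.Negative.Basic
import Summits.ValiantsHypothesis.ValiantsHypothesis.Theorems.DivisionGapTriangularDimersDivisionEasyStubFreeInitialForms
import Summits.ValiantsHypothesis.ValiantsHypothesis.Theorems.DivisionGapTriangularDimersDivisionEasyStubRhombusExtraction
import Summits.ValiantsHypothesis.ValiantsHypothesis.Theorems.DivisionGapTriangularDimersDivisionEasyStubFaceLow
import Summits.ValiantsHypothesis.ValiantsHypothesis.Theorems.DivisionGapTriangularDimersDivisionEasyStubPmSum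
import Summits.ValiantsHypothesis.ValiantsHypothesis.Theorems.DivisionGapTriangularDimersDivisionEasyStubBoundAbsorb
import Summits.ValiantsHypothesis.ValiantsHypothesis.Theorems.DivisionGapTriangularDimersDivisionEasyStubSwapIdentity
import Summits.ValiantsHypothesis.ValiantsHypothesis.Theorems.DivisionGapTriangularDimersDivisionEasyStubSubstIdentity
import Summits.ValiantsHypothesis.ValiantsHypothesis.Theorems.DivisionGapTriangularDimersDivisionEasyStubEvenTransfer

/-!
# Crux `DivisionGap.TriangularDimersDivisionEasy` (stmt-ValiantsHypothesis-5067), line `Sketch` — the two REDUCTIONS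
of the crux, kernel-checked (registered helper stubs `crux_of_oddJoinDivisionEasy`, `crux_of_evenSubgraphDivisionEasy`)

The line `Sketch` (idea card `hight-ising-face`: odd-join face lift) is CLOSED MODULO its one open stub
`stub_oddJoinDivisionEasy : DivEasy oddJoin`.  This file records, as theorems of the tree, exactly what remains:

* `crux_of_oddJoinDivisionEasy : DivEasy oddJoin → TriangularDimersDivisionEasy` — quasi-polynomial division
  complexity (normal form `F · h = g`, `h ≠ 0`, both monotone-easy over `ℝ≥0`) of the ODD-JOIN polynomials
  `oddJoin n = Σ_{J odd} Π_{e∈J} y_e Π_{e∉J} (1 + y_e)` of the triangular rhombi (numerators of the all-spin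
  correlator `Z⟨Π_v σ_v⟩` of the ferromagnetic Ising model on `R_n`, `tanh J_e = y_e/(1+y_e)`) implies the crux:
  initial forms are free over `ℝ≥0` (`Shuffling.stub_freeInitialForms`, `Shuffling.Extraction.extract`) and the
  lowest face of `oddJoin n` is `D_n` (`stub_faceIdentity` = `stub_oddJoinWeights` + `stub_faceCoeffLow` ∘ `stub_pmSum`, used through the latter).
* `crux_of_evenSubgraphDivisionEasy : DivEasy evenSplit → TriangularDimersDivisionEasy` — the SOURCELESS
  strengthening: quasi-polynomial division complexity of the EVEN-SUBGRAPH polynomials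
  `evenSplit n = Σ_{H even} Π_{e∈H} x_e Π_{e∉H} x_(e.swap)` (cycle-space / high-temperature Ising generating polynomial of
  `R_n` in split variables; by planar duality the sourceless ferromagnetic Ising partition function of the dual region in
  Boltzmann coordinates) implies the crux, via the free variable swap along one perfect matching and the monotone chart
  map (`stub_evenTransfer` fed with `stub_boundAbsorb`, `stub_swapIdentity`, `stub_substIdentity`).

Consequently a proof of either hypothesis closes stmt-ValiantsHypothesis-5067 in one line, and — contrapositively — the
crux's standing negative results (`Negative.false_without_division` etc.) transfer to both Ising polynomials WITHOUT
division for free (their `D_n`-face is free).  Both hypotheses are open (FGK 2014 Rem. 1.5 territory); neither is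
asserted here.  No `def` is declared. [cite: FominGrigorievKoshevoy2014, Rem. 1.5]
-/

-- `Summit.ValiantsHypothesis.ValiantsHypothesis.…` is the tree's mandated single-conjunct layout (Sub = Summit).
set_option linter.dupNamespace false

namespace Summit.ValiantsHypothesis.ValiantsHypothesis.Theorems.TriangularDimersDivisionEasy.OddJoin

open scoped BigOperators NNReal
open Finset MvPolynomial Literature.Computability.AlgebraicComplexity

noncomputable section

/-- **Registered helper `crux_of_oddJoinDivisionEasy`** (line `Sketch`, composition of stubs 1–3): quasi-polynomial
division complexity of the odd-join polynomials of the triangular rhombi implies the crux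
`TriangularDimersDivisionEasy`.  Given the witness `h` at level `n`, `Shuffling.Extraction.extract` (initial forms are
free, `Shuffling.stub_freeInitialForms`) yields `HL = in(h) ≠ 0` with `L₊(HL) ≤ L₊(h)` and
`L₊(in(oddJoin n) · HL) ≤ L₊(oddJoin n · h)`, and `in(oddJoin n) = D_n` by the face identity (`stub_faceCoeffLow` ∘ `stub_pmSum`); same constant `c`.
[folklore] -/
theorem crux_of_oddJoinDivisionEasy (h : DivEasy oddJoin) :
    Summit.ValiantsHypothesis.ValiantsHypothesis.Theses.DivisionGap.TriangularDimersDivisionEasy := by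
  rw [Negative.crux_iff]
  obtain ⟨c, hc⟩ := h
  refine ⟨c, fun n => ?_⟩
  obtain ⟨q, q0, hb⟩ := hc n
  have hw := stub_oddJoinWeights n
  have hface := (stub_faceCoeffLow n).trans (stub_pmSum n)
  obtain ⟨HL, hHL0, hHLc, hc2⟩ :=
    Shuffling.Extraction.extract Shuffling.stub_freeInitialForms (fun _ => (1 : ℕ)) (oddJoin n) q (n * n) q0 hw
  refine ⟨HL, hHL0, ?_⟩
  rw [hface] at hc2
  exact le_trans (Nat.add_le_add hc2 hHLc) hb

/-- **Registered helper `crux_of_evenSubgraphDivisionEasy`** (line `Sketch`, the sourceless strengthening, composition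
of stubs 1, 3–7): quasi-polynomial division complexity of the even-subgraph (cycle-space) polynomials of the triangular
rhombi in split variables implies the crux `TriangularDimersDivisionEasy`. [folklore] -/
theorem crux_of_evenSubgraphDivisionEasy (h : DivEasy evenSplit) :
    Summit.ValiantsHypothesis.ValiantsHypothesis.Theses.DivisionGap.TriangularDimersDivisionEasy :=
  crux_of_oddJoinDivisionEasy (stub_evenTransfer stub_boundAbsorb stub_swapIdentity stub_substIdentity h)

end

end Summit.ValiantsHypothesis.ValiantsHypothesis.Theorems.TriangularDimersDivisionEasy.OddJoin
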